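import Literature.NumberTheory.Sieve.SmoothSaddlePointXi
import HarnessLib

/-!
# The prime sums `Σ_{p ≤ z} (log p/p) ρ(u - log p/log y)` (Hildebrand's induction, analytic input)

Topic `Literature/NumberTheory/Sieve`; a PROVED tool file toward `Literature.NumberTheory.Sieve.HTLocalBehaviour`
(Hildebrand–Tenenbaum 1986, Theorem 3) in the range of small `u`, via the de Bruijn–Hildebrand asymptotic
`Ψ(x, y) = xρ(u)(1 + O(·))` [Hildebrand1986, Thm 1] proved by induction along Hildebrand's identity
(`SmoothCountHildebrandIdentity.lean`). The analytic input of that induction [Hildebrand1986, Lemma 4] is the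
evaluation of `Σ_{p ≤ y^θ} (log p/p) ρ(u - log p/log y)` by the prime number theorem; we prove a crude version
(absolute error `O(ρ(u - 1))`, from `θ(t) = t + O(t/log² t)`):

* `hasDerivAt_dickmanRho_of_one_lt` — `ρ'(u) = -ρ(u-1)/u` at every `u > 1` (integers included);
* `abs_sum_primesLE_log_div_mul_sub_integral_le` — **partial summation**: for `f ≥ 0` non-decreasing and `C¹`
  on `[2, z]` with `f ≤ M`: `|Σ_{p ≤ z} (log p/p) f(p) - ∫₂^z f(t) dt/t| ≤ C M`;
* `abs_weightedPrimeSum_sub_le` — `|Σ_{p ≤ y} (log p/p) ρ(u - log p/log y) - u ρ(u) log y| ≤ C ρ(u - 1)` (`u ≥ 2`);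
* `weightedPrimeSum_sqrt_le` — `Σ_{p ≤ √y} (log p/p) ρ(u - log p/log y) ≤ (u ρ(u) log y)/2 + C ρ(u - 1)`
  (`ρ(u - s)` increases with `s`, so `∫₀^{1/2} ρ(u - s) ds ≤ ½ ∫₀¹ ρ(u - s) ds = u ρ(u)/2`: the weight of the
  primes `p ≤ √y` is at most one half [Hildebrand1986, §3, "the quantity … is nonnegative"]).

## References

* [Hildebrand1986] A. Hildebrand, J. Number Theory 22 (1986) 289–307, Lemma 1 (ii), (iv), Lemma 4 and §3.
* [HildebrandTenenbaum1986] A. Hildebrand, G. Tenenbaum, Trans. AMS 296 (1986) 265–290, §1 (1.5).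
-/

noncomputable section

open Real Filter Finset MeasureTheory Chebyshev Set

open scoped Topology

namespace Literature.NumberTheory.Sieve

namespace HildebrandInduction

/-! ### `ρ` is differentiable on `(1, ∞)` -/

/-- `ρ'(u) = -ρ(u - 1)/u` for every `u > 1` (at integers `n ≥ 2` the one-sided derivatives
`-ρ_{n-2}(n-1)/n` and `-ρ_{n-1}(n-1)/n` agree). [cite: Hildebrand1986, Lemma 1 (ii)] -/
theorem hasDerivAt_dickmanRho_of_one_lt {u : ℝ} (hu : 1 < u) :
    HasDerivAt dickmanRho (-(dickmanRho (u - 1) / u)) u := by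
  by_cases hnot : (⌊u⌋₊ : ℝ) < u
  · exact hasDerivAt_dickmanRho hu hnot
  · -- `u = n` is an integer `≥ 2`
    have hu0 : 0 ≤ u := by linarith
    have hun : u = ⌊u⌋₊ := le_antisymm (not_lt.1 hnot) (Nat.floor_le hu0)
    set n : ℕ := ⌊u⌋₊ with hn
    have hn2 : 2 ≤ n := by
      by_contra h
      push Not at h
      have : (n : ℝ) ≤ 1 := by exact_mod_cast Nat.lt_succ_iff.1 h
      linarith
    obtain ⟨m, hm⟩ : ∃ m, n = m + 2 := ⟨n - 2, by omega⟩
    have hum : u = (m : ℝ) + 2 := by rw [hun, hm]; push_cast; ring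
    -- right derivative
    have hright := hasDerivWithinAt_dickmanRho hu.le
    -- left derivative: `ρ = ρ_{m+1}` on `[m+1, m+2]`
    have hval : dickmanRho u = dickmanPiece (m + 1) u :=
      dickmanRho_eq_piece ⟨by push_cast; linarith, by push_cast; linarith⟩
    have heq : dickmanRho =ᶠ[𝓝[Set.Iic u] u] dickmanPiece (m + 1) := by
      have hmem : Set.Ioc ((m : ℝ) + 1) u ∈ 𝓝[Set.Iic u] u := Ioc_mem_nhdsLE (by linarith)
      filter_upwards [hmem] with v hv
      exact dickmanRho_eq_piece ⟨by push_cast; linarith [hv.1], by push_cast; linarith [hv.2]⟩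
    have hprev : dickmanRho (u - 1) = dickmanPiece m (u - 1) := by
      have h1 : u - 1 = (m : ℝ) + 1 := by linarith
      rw [h1, show ((m : ℝ) + 1) = ((m + 1 : ℕ) : ℝ) by push_cast; ring, dickmanRho,
        Nat.floor_natCast, show ((m + 1 : ℕ) : ℝ) = (m : ℝ) + 1 by push_cast; ring]
      exact dickmanPiece_succ_self m
    have hmax : max u 1 = u := max_eq_left hu.le
    have hd := (hasDerivAt_dickmanPiece_succ m u).hasDerivWithinAt (s := Set.Iic u)
    rw [hmax, ← hprev] at hd
    have hleft : HasDerivWithinAt dickmanRho (-(dickmanRho (u - 1) / u)) (Set.Iic u) u :=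
      hd.congr_of_eventuallyEq heq hval
    have h := hleft.union hright
    rwa [Set.Iic_union_Ici, hasDerivWithinAt_univ] at h

/-! ### Partial summation against `θ(t) = t + O(t/log² t)` -/

/-- **Partial summation.** There is an absolute `C` such that for every `z ≥ 2`, every `M`, and every `f`
which is `C¹`, non-negative, non-decreasing and `≤ M` on `[2, z]`:
`|Σ_{p ≤ z} (log p/p) f(p) - ∫₂^z f(t) dt/t| ≤ C M`.
(Abel summation with `θ`, `θ(t) = t + E(t)`, `|E(t)| ≤ C₀ t/log² t`, an integration by parts, and
`∫₂^z |E| |(f/t)'| ≤ C₀ (∫ f'/log² 2 + M ∫ dt/(t log² t)) ≤ C₀ M (1/log² 2 + 1/log 2)`.)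
[cite: Hildebrand1986, Lemma 4 (proof, partial summation)] -/
theorem abs_sum_primesLE_log_div_mul_sub_integral_le :
    ∃ C : ℝ, 0 ≤ C ∧ ∀ (f f' : ℝ → ℝ) (M z : ℝ), 2 ≤ z →
      (∀ t ∈ Set.Icc 2 z, HasDerivAt f (f' t) t) → ContinuousOn f' (Set.Icc 2 z) →
      (∀ t ∈ Set.Icc 2 z, 0 ≤ f' t) → (∀ t ∈ Set.Icc 2 z, 0 ≤ f t) → (∀ t ∈ Set.Icc 2 z, f t ≤ M) →
      |∑ p ∈ Nat.primesLE ⌊z⌋₊, Real.log p / p * f p - ∫ t in (2 : ℝ)..z, f t / t| ≤ C * M := by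
  obtain ⟨C₀, hC₀, hθ⟩ := LFunctions.Mertens.exists_abs_theta_sub_le_div_log_pow 2
  have hl2 : 0 < Real.log 2 := Real.log_pos one_lt_two
  refine ⟨1 + 2 * C₀ / Real.log 2 ^ 2 + C₀ / Real.log 2, by positivity, ?_⟩
  intro f f' M z hz hf hf'c hf'0 hf0 hfM
  have hz0 : 0 < z := by linarith
  have hM : 0 ≤ M := (hf0 2 ⟨le_rfl, hz⟩).trans (hfM 2 ⟨le_rfl, hz⟩)
  -- `F = f/t`, `F' = f'/t - f/t²`
  set F : ℝ → ℝ := fun t => f t / t with hF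
  set F' : ℝ → ℝ := fun t => f' t / t - f t / t ^ 2 with hF'
  have hFd : ∀ t ∈ Set.Icc 2 z, HasDerivAt F (F' t) t := by
    intro t ht
    have ht0 : t ≠ 0 := by linarith [ht.1]
    have h := (hf t ht).div (hasDerivAt_id t) ht0
    have h2 : (f' t * id t - f t * 1) / id t ^ 2 = F' t := by
      simp only [hF', id]
      field_simp
    rw [h2] at h
    exact h
  have hfc : ContinuousOn f (Set.Icc 2 z) := fun t ht => (hf t ht).continuousAt.continuousWithinAt
  have hF'c : ContinuousOn F' (Set.Icc 2 z) := by
    rw [hF']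
    refine ContinuousOn.sub (hf'c.div continuousOn_id fun t ht => ne_of_gt (show (0 : ℝ) < t by linarith [ht.1]))
      (hfc.div (continuousOn_pow 2) fun t ht => pow_ne_zero 2 (ne_of_gt (show (0 : ℝ) < t by linarith [ht.1])))
  have hFc : ContinuousOn F (Set.Icc 2 z) :=
    hfc.div continuousOn_id fun t ht => ne_of_gt (show (0 : ℝ) < t by linarith [ht.1])
  -- Abel summation
  set c : ℕ → ℝ := fun n => if n.Prime then Real.log n else 0 with hc
  have hc0 : c 0 = 0 := by simp [hc, Nat.not_prime_zero]
  have hc1 : c 1 = 0 := by simp [hc, Nat.not_prime_one]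
  have hθc : ∀ t : ℝ, ∑ k ∈ Icc 0 ⌊t⌋₊, c k = θ t := by
    intro t; rw [theta_eq_sum_Icc, Finset.sum_filter]
  have hdiff : ∀ t ∈ Set.Icc (2 : ℝ) z, DifferentiableAt ℝ F t := fun t ht => (hFd t ht).differentiableAt
  have hderiv : ∀ t ∈ Set.Icc (2 : ℝ) z, deriv F t = F' t := fun t ht => (hFd t ht).deriv
  have hint : IntegrableOn (deriv F) (Set.Icc (2 : ℝ) z) :=
    (hF'c.integrableOn_Icc).congr_fun (fun t ht => (hderiv t ht).symm) measurableSet_Icc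
  have habel := sum_mul_eq_sub_integral_mul₁ c hc0 hc1 z hdiff hint
  have hlhs : ∑ k ∈ Icc 0 ⌊z⌋₊, F k * c k = ∑ p ∈ Nat.primesLE ⌊z⌋₊, Real.log p / p * f p := by
    rw [Nat.primesLE_eq_filter_Icc_zero, Finset.sum_filter]
    refine Finset.sum_congr rfl fun k _ => ?_
    by_cases hk : k.Prime
    · simp only [hc, hk, if_true, hF]; ring
    · simp [hc, hk]
  rw [hlhs, hθc z] at habel
  -- the integral `∫ F' θ = ∫ t F' + ∫ E F'`
  have hIoc : ∫ t in Set.Ioc (2 : ℝ) z, deriv F t * ∑ k ∈ Icc 0 ⌊t⌋₊, c k = ∫ t in (2 : ℝ)..z, F' t * θ t := by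
    rw [intervalIntegral.integral_of_le hz]
    refine setIntegral_congr_fun measurableSet_Ioc fun t ht => ?_
    rw [hθc t, hderiv t ⟨ht.1.le, ht.2⟩]
  rw [hIoc] at habel
  have hF'i : IntervalIntegrable F' volume 2 z := (hF'c.mono (by rw [Set.uIcc_of_le hz])).intervalIntegrable
  have hFi : IntervalIntegrable F volume 2 z := (hFc.mono (by rw [Set.uIcc_of_le hz])).intervalIntegrable
  have hθF'i : IntervalIntegrable (fun t => F' t * θ t) volume 2 z := by
    have := (theta_mono.intervalIntegrable (μ := volume) (a := 2) (b := z)).continuousOn_mul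
      (hF'c.mono (by rw [Set.uIcc_of_le hz]))
    exact this
  have htF'i : IntervalIntegrable (fun t => F' t * t) volume 2 z :=
    hF'i.mul_continuousOn continuousOn_id
  have hsplit : ∫ t in (2 : ℝ)..z, F' t * θ t = (∫ t in (2 : ℝ)..z, F' t * t) + ∫ t in (2 : ℝ)..z, F' t * (θ t - t) := by
    rw [← intervalIntegral.integral_add htF'i]
    · exact intervalIntegral.integral_congr fun t _ => by ring
    · exact (hθF'i.sub htF'i).congr fun t _ => by ring
  -- integration by parts: `∫₂^z t F'(t) dt = z F(z) - 2 F(2) - ∫₂^z F`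
  have hparts : ∫ t in (2 : ℝ)..z, F' t * t = z * F z - 2 * F 2 - ∫ t in (2 : ℝ)..z, F t := by
    have h := intervalIntegral.integral_mul_deriv_eq_deriv_mul (a := (2 : ℝ)) (b := z) (u := fun t => t)
      (u' := fun _ => (1 : ℝ)) (v := F) (v' := F') (fun t _ => hasDerivAt_id t)
      (fun t ht => hFd t (by rwa [Set.uIcc_of_le hz] at ht)) intervalIntegrable_const hF'i
    simp only [one_mul] at h
    rw [show (∫ t in (2 : ℝ)..z, F' t * t) = ∫ t in (2 : ℝ)..z, t * F' t from
      intervalIntegral.integral_congr fun t _ => by ring, h]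
  -- error terms
  have hE2 : |2 * F 2| ≤ M := by
    rw [hF]; simp only
    rw [show (2 : ℝ) * (f 2 / 2) = f 2 by ring, abs_of_nonneg (hf0 2 ⟨le_rfl, hz⟩)]
    exact hfM 2 ⟨le_rfl, hz⟩
  have hEz : |F z * (θ z - z)| ≤ C₀ / Real.log 2 ^ 2 * M := by
    have hlz : Real.log 2 ≤ Real.log z := Real.log_le_log two_pos hz
    have hfz0 := hf0 z ⟨hz, le_rfl⟩
    rw [abs_mul, hF]; simp only
    rw [abs_of_nonneg (div_nonneg hfz0 hz0.le)]
    calc f z / z * |θ z - z| ≤ f z / z * (C₀ * z / Real.log z ^ 2) :=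
          mul_le_mul_of_nonneg_left (hθ z hz) (div_nonneg hfz0 hz0.le)
      _ = C₀ / Real.log z ^ 2 * f z := by field_simp
      _ ≤ C₀ / Real.log 2 ^ 2 * M := by
          refine mul_le_mul ?_ (hfM z ⟨hz, le_rfl⟩) hfz0 (by positivity)
          exact div_le_div_of_nonneg_left hC₀ (by positivity) (by gcongr)
  have hEint : |∫ t in (2 : ℝ)..z, F' t * (θ t - t)| ≤ C₀ / Real.log 2 ^ 2 * M + C₀ / Real.log 2 * M := by
    -- pointwise `|F'(t)| |E(t)| ≤ C₀ f'(t)/log² 2 + C₀ M/(t log² t)`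
    have hpt : ∀ t ∈ Set.Ioc (2 : ℝ) z, ‖F' t * (θ t - t)‖ ≤
        C₀ / Real.log 2 ^ 2 * f' t + C₀ * M * (1 / (t * Real.log t ^ 2)) := by
      intro t ht
      have ht2 : 2 ≤ t := ht.1.le
      have ht0 : 0 < t := by linarith
      have htI : t ∈ Set.Icc 2 z := ⟨ht2, ht.2⟩
      have hlt : Real.log 2 ≤ Real.log t := Real.log_le_log two_pos ht2
      have hlt0 : 0 < Real.log t := lt_of_lt_of_le hl2 hlt
      have hf't := hf'0 t htI
      have hft := hf0 t htI
      rw [Real.norm_eq_abs, abs_mul]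
      have h1 : |F' t| ≤ f' t / t + f t / t ^ 2 := by
        rw [hF']; simp only
        refine (abs_sub _ _).trans ?_
        rw [abs_of_nonneg (div_nonneg hf't ht0.le), abs_of_nonneg (by positivity)]
      have h2 := hθ t ht2
      calc |F' t| * |θ t - t| ≤ (f' t / t + f t / t ^ 2) * (C₀ * t / Real.log t ^ 2) :=
            mul_le_mul h1 h2 (abs_nonneg _) (by positivity)
        _ = C₀ / Real.log t ^ 2 * f' t + C₀ * f t * (1 / (t * Real.log t ^ 2)) := by
            field_simp
        _ ≤ C₀ / Real.log 2 ^ 2 * f' t + C₀ * M * (1 / (t * Real.log t ^ 2)) := by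
            gcongr
            exact hfM t htI
    have hi1 : IntervalIntegrable (fun t => C₀ / Real.log 2 ^ 2 * f' t) volume 2 z :=
      (hf'c.mono (by rw [Set.uIcc_of_le hz])).intervalIntegrable.const_mul _
    have hi2 : IntervalIntegrable (fun t => C₀ * M * (1 / (t * Real.log t ^ 2))) volume 2 z := by
      refine IntervalIntegrable.const_mul ?_ _
      refine ContinuousOn.intervalIntegrable ?_
      rw [Set.uIcc_of_le hz]
      refine ContinuousOn.div continuousOn_const (continuousOn_id.mul ((continuousOn_log.mono ?_).pow 2)) ?_
      · intro t ht; exact ne_of_gt (by linarith [ht.1])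
      · intro t ht
        have : 0 < Real.log t := Real.log_pos (by linarith [ht.1])
        have : 0 < t := by linarith [ht.1]
        positivity
    have hbound_int := hi1.add hi2
    have h := intervalIntegral.norm_integral_le_of_norm_le hz (Filter.Eventually.of_forall hpt) hbound_int
    rw [Real.norm_eq_abs] at h
    refine h.trans ?_
    rw [intervalIntegral.integral_add hi1 hi2,
      intervalIntegral.integral_const_mul, intervalIntegral.integral_const_mul,
      integral_inv_mul_log_sq one_lt_two hz,
      intervalIntegral.integral_eq_sub_of_hasDerivAt (fun t ht => hf t (by rwa [Set.uIcc_of_le hz] at ht))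
        ((hf'c.mono (by rw [Set.uIcc_of_le hz])).intervalIntegrable)]
    have hfz := hfM z ⟨hz, le_rfl⟩
    have hf2 := hf0 2 ⟨le_rfl, hz⟩
    have hlz : 0 < Real.log z := Real.log_pos (by linarith)
    have h3 : 1 / Real.log 2 - 1 / Real.log z ≤ 1 / Real.log 2 := by
      have : 0 ≤ 1 / Real.log z := by positivity
      linarith
    calc C₀ / Real.log 2 ^ 2 * (f z - f 2) + C₀ * M * (1 / Real.log 2 - 1 / Real.log z)
        ≤ C₀ / Real.log 2 ^ 2 * M + C₀ * M * (1 / Real.log 2) := by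
          gcongr
          linarith
      _ = C₀ / Real.log 2 ^ 2 * M + C₀ / Real.log 2 * M := by ring
  -- assemble
  have hkey : ∑ p ∈ Nat.primesLE ⌊z⌋₊, Real.log p / p * f p - ∫ t in (2 : ℝ)..z, f t / t =
      2 * F 2 + F z * (θ z - z) - ∫ t in (2 : ℝ)..z, F' t * (θ t - t) := by
    rw [habel, hsplit, hparts]
    have : (∫ t in (2 : ℝ)..z, f t / t) = ∫ t in (2 : ℝ)..z, F t := rfl
    rw [this]
    ring
  rw [hkey]
  calc |2 * F 2 + F z * (θ z - z) - ∫ t in (2 : ℝ)..z, F' t * (θ t - t)|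
      ≤ |2 * F 2| + |F z * (θ z - z)| + |∫ t in (2 : ℝ)..z, F' t * (θ t - t)| := abs_sub_le_of_le _ _ _
    _ ≤ M + C₀ / Real.log 2 ^ 2 * M + (C₀ / Real.log 2 ^ 2 * M + C₀ / Real.log 2 * M) := by
        gcongr
    _ = (1 + 2 * C₀ / Real.log 2 ^ 2 + C₀ / Real.log 2) * M := by ring
where
  /-- `|a + b - c| ≤ |a| + |b| + |c|`. -/
  abs_sub_le_of_le (a b c : ℝ) : |a + b - c| ≤ |a| + |b| + |c| := by
    calc |a + b - c| ≤ |a + b| + |c| := abs_sub _ _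
      _ ≤ |a| + |b| + |c| := by linarith [abs_add_le a b]

/-! ### The weight `f(t) = ρ(u - log t/log y)` -/

/-- Calculus of `f(t) = ρ(u - log t/L)` on `[2, z]`, `z ≤ y = e^L`, `u > 2`: `f` is `C¹` with
`f'(t) = ρ(v - 1)/(v t L) ≥ 0` (`v = u - log t/L ≥ u - 1 > 1`) and `0 ≤ f ≤ ρ(u - 1)`. [folklore] -/
theorem weight_calculus {u L z : ℝ} (hu : 2 < u) (hL : 0 < L) (hz : Real.log z ≤ L) :
    (∀ t ∈ Set.Icc 2 z, HasDerivAt (fun t => dickmanRho (u - Real.log t / L))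
        (dickmanRho (u - Real.log t / L - 1) / (u - Real.log t / L) * (1 / (t * L))) t) ∧
    ContinuousOn (fun t => dickmanRho (u - Real.log t / L - 1) / (u - Real.log t / L) * (1 / (t * L))) (Set.Icc 2 z) ∧
    (∀ t ∈ Set.Icc 2 z, 0 ≤ dickmanRho (u - Real.log t / L - 1) / (u - Real.log t / L) * (1 / (t * L))) ∧
    (∀ t ∈ Set.Icc 2 z, 0 ≤ dickmanRho (u - Real.log t / L)) ∧
    (∀ t ∈ Set.Icc 2 z, dickmanRho (u - Real.log t / L) ≤ dickmanRho (u - 1)) := by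
  have hv : ∀ t ∈ Set.Icc 2 z, u - 1 ≤ u - Real.log t / L := by
    intro t ht
    have : Real.log t ≤ L := (Real.log_le_log (by linarith [ht.1]) ht.2).trans hz
    have : Real.log t / L ≤ 1 := by rw [div_le_one hL]; exact this
    linarith
  refine ⟨fun t ht => ?_, ?_, fun t ht => ?_, fun t _ => dickmanRho_nonneg _, fun t ht => dickmanRho_antitone (hv t ht)⟩
  · have ht0 : 0 < t := by linarith [ht.1]
    have hv1 : 1 < u - Real.log t / L := by linarith [hv t ht]
    have hinner : HasDerivAt (fun t => u - Real.log t / L) (-(t⁻¹ / L)) t :=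
      ((Real.hasDerivAt_log ht0.ne').div_const L).const_sub u
    have h := (hasDerivAt_dickmanRho_of_one_lt hv1).comp t hinner
    have h2 : -(dickmanRho (u - Real.log t / L - 1) / (u - Real.log t / L)) * -(t⁻¹ / L) =
        dickmanRho (u - Real.log t / L - 1) / (u - Real.log t / L) * (1 / (t * L)) := by
      field_simp
    rw [h2] at h
    exact h
  · have hcv : ContinuousOn (fun t => u - Real.log t / L) (Set.Icc 2 z) :=
      continuousOn_const.sub ((continuousOn_log.mono fun t ht => ne_of_gt (by linarith [ht.1] : (0 : ℝ) < t)).div_const L)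
    refine ContinuousOn.mul (ContinuousOn.div ?_ hcv fun t ht => ne_of_gt (by linarith [hv t ht])) ?_
    · exact continuous_dickmanRho.comp_continuousOn (hcv.sub continuousOn_const)
    · refine ContinuousOn.div continuousOn_const (continuousOn_id.mul continuousOn_const) fun t ht => ?_
      exact mul_ne_zero (ne_of_gt (show (0 : ℝ) < t by linarith [ht.1])) hL.ne'
  · have ht0 : 0 < t := by linarith [ht.1]
    have hv0 : 0 < u - Real.log t / L := by linarith [hv t ht]
    have := dickmanRho_nonneg (u - Real.log t / L - 1)
    positivity

/-- Substitution `t = y^s`: `∫₂^z ρ(u - log t/L) dt/t = L ∫_{log 2/L}^{log z/L} ρ(u - s) ds` (`2 ≤ z`, `L > 0`).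
[folklore] -/
theorem integral_weight_div_eq {u L z : ℝ} (hL : 0 < L) (hz : 2 ≤ z) :
    ∫ t in (2 : ℝ)..z, dickmanRho (u - Real.log t / L) / t =
      L * ∫ s in (Real.log 2 / L)..(Real.log z / L), dickmanRho (u - s) := by
  have hcont : Continuous fun w : ℝ => dickmanRho (u - w / L) :=
    continuous_dickmanRho.comp (continuous_const.sub (continuous_id.div_const L))
  have h1 := intervalIntegral.integral_comp_mul_deriv' (a := (2 : ℝ)) (b := z) (f := Real.log) (f' := fun t => t⁻¹)
    (g := fun w => dickmanRho (u - w / L)) (fun t ht => Real.hasDerivAt_log (by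
      rw [Set.uIcc_of_le hz] at ht; exact ne_of_gt (by linarith [ht.1])))
    (continuousOn_inv₀.mono fun t ht => by
      rw [Set.uIcc_of_le hz] at ht; exact ne_of_gt (show (0 : ℝ) < t by linarith [ht.1])) hcont.continuousOn
  have h2 : (∫ t in (2 : ℝ)..z, dickmanRho (u - Real.log t / L) / t) =
      ∫ t in (2 : ℝ)..z, ((fun w => dickmanRho (u - w / L)) ∘ Real.log) t * t⁻¹ :=
    intervalIntegral.integral_congr fun t _ => by simp only [Function.comp_apply, div_eq_mul_inv]
  rw [h2, h1]
  have h3 := intervalIntegral.integral_comp_div (a := Real.log 2) (b := Real.log z) (fun s => dickmanRho (u - s)) hL.ne'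
  simp only [smul_eq_mul] at h3
  rw [← h3]

/-- `∫₀¹ ρ(u - s) ds = u ρ(u)` (`u ≥ 1`). [cite: Hildebrand1986, Lemma 1 (ii)] -/
theorem integral_dickmanRho_sub_eq {u : ℝ} (hu : 1 ≤ u) : ∫ s in (0 : ℝ)..1, dickmanRho (u - s) = u * dickmanRho u := by
  rw [intervalIntegral.integral_comp_sub_left (fun v => dickmanRho v) u, sub_zero, mul_dickmanRho_eq_integral hu]

/-- `∫₀^{1/2} ρ(u - s) ds ≤ u ρ(u)/2`: `ρ(u - s) ≤ ρ(u - s - ½)` and the two halves add up to `u ρ(u)`.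
[cite: Hildebrand1986, §3 ("the quantity … is nonnegative")] -/
theorem integral_dickmanRho_sub_half_le {u : ℝ} (hu : 1 ≤ u) :
    ∫ s in (0 : ℝ)..(1 / 2), dickmanRho (u - s) ≤ u * dickmanRho u / 2 := by
  have hc : Continuous fun s : ℝ => dickmanRho (u - s) := continuous_dickmanRho.comp (continuous_const.sub continuous_id)
  have h1 : ∫ s in (0 : ℝ)..(1 / 2), dickmanRho (u - s) ≤ ∫ s in (0 : ℝ)..(1 / 2), dickmanRho (u - (s + 1 / 2)) := by
    refine intervalIntegral.integral_mono_on (by norm_num) (hc.intervalIntegrable _ _)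
      ((continuous_dickmanRho.comp (continuous_const.sub (continuous_id.add continuous_const))).intervalIntegrable _ _)
      fun s _ => dickmanRho_antitone (by linarith)
  have h2 : ∫ s in (0 : ℝ)..(1 / 2), dickmanRho (u - (s + 1 / 2)) = ∫ s in (1 / 2 : ℝ)..1, dickmanRho (u - s) := by
    rw [intervalIntegral.integral_comp_add_right (fun s => dickmanRho (u - s)) (1 / 2 : ℝ)]
    norm_num
  have h3 : (∫ s in (0 : ℝ)..(1 / 2), dickmanRho (u - s)) + ∫ s in (1 / 2 : ℝ)..1, dickmanRho (u - s) = u * dickmanRho u := by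
    rw [intervalIntegral.integral_add_adjacent_intervals (hc.intervalIntegrable _ _) (hc.intervalIntegrable _ _),
      integral_dickmanRho_sub_eq hu]
  linarith

/-! ### The prime sums -/

/-- **The weight sum over all `p ≤ y`.** There is an absolute `C` with
`|Σ_{p ≤ y} (log p/p) ρ(u - log p/log y) - u ρ(u) log y| ≤ C ρ(u - 1)` for `u > 2`, `y ≥ 4`
(a crude form of [Hildebrand1986, Lemma 4] with `θ = 1`, `σ = 1`).
[cite: Hildebrand1986, Lemma 4] -/
theorem abs_weightedPrimeSum_sub_le :
    ∃ C : ℝ, 0 ≤ C ∧ ∀ (u : ℝ) (y : ℕ), 2 < u → 4 ≤ y →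
      |∑ p ∈ Nat.primesLE y, Real.log p / p * dickmanRho (u - Real.log p / Real.log y) -
          u * dickmanRho u * Real.log y| ≤ C * dickmanRho (u - 1) := by
  obtain ⟨C, hC0, hC⟩ := abs_sum_primesLE_log_div_mul_sub_integral_le
  refine ⟨C + 1, by positivity, fun u y hu hy => ?_⟩
  have hy4 : (4 : ℝ) ≤ y := by exact_mod_cast hy
  have hy2 : (2 : ℝ) ≤ y := by linarith
  set L := Real.log y with hL
  have hL0 : 0 < L := Real.log_pos (by linarith)
  obtain ⟨hd, hc, h0', h0, hM⟩ := weight_calculus (z := (y : ℝ)) hu hL0 le_rfl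
  have h1 := hC _ _ (dickmanRho (u - 1)) (y : ℝ) hy2 hd hc h0' h0 hM
  rw [Nat.floor_natCast, integral_weight_div_eq hL0 hy2] at h1
  -- `L ∫_{log 2/L}^{1} ρ(u-s) ds = u L ρ(u) - L ∫_0^{log 2/L} ρ(u-s) ds`
  have hcont : Continuous fun s : ℝ => dickmanRho (u - s) := continuous_dickmanRho.comp (continuous_const.sub continuous_id)
  have hLL : Real.log y / L = 1 := div_self hL0.ne'
  have hsplit : ∫ s in (Real.log 2 / L)..1, dickmanRho (u - s) =
      u * dickmanRho u - ∫ s in (0 : ℝ)..(Real.log 2 / L), dickmanRho (u - s) := by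
    rw [← integral_dickmanRho_sub_eq (by linarith), ← intervalIntegral.integral_add_adjacent_intervals
      (a := (0 : ℝ)) (b := Real.log 2 / L) (c := (1 : ℝ)) (hcont.intervalIntegrable _ _) (hcont.intervalIntegrable _ _)]
    ring
  have hl2 : 0 < Real.log 2 := Real.log_pos one_lt_two
  have hl2L : Real.log 2 / L ≤ 1 := by
    rw [div_le_one hL0]; exact Real.log_le_log two_pos hy2
  have hsmall : 0 ≤ ∫ s in (0 : ℝ)..(Real.log 2 / L), dickmanRho (u - s) ∧
      L * ∫ s in (0 : ℝ)..(Real.log 2 / L), dickmanRho (u - s) ≤ dickmanRho (u - 1) := by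
    constructor
    · exact intervalIntegral.integral_nonneg (by positivity) fun s _ => dickmanRho_nonneg _
    · have h2 : ∫ s in (0 : ℝ)..(Real.log 2 / L), dickmanRho (u - s) ≤ ∫ _s in (0 : ℝ)..(Real.log 2 / L), dickmanRho (u - 1) := by
        refine intervalIntegral.integral_mono_on (by positivity) (hcont.intervalIntegrable _ _)
          (continuous_const.intervalIntegrable _ _) fun s hs => dickmanRho_antitone ?_
        linarith [hs.2]
      rw [intervalIntegral.integral_const, smul_eq_mul, sub_zero] at h2
      have h3 : Real.log 2 ≤ 1 := by
        have := Real.log_le_sub_one_of_pos (show (0 : ℝ) < 2 by norm_num); linarith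
      have hρ := dickmanRho_nonneg (u - 1)
      calc L * ∫ s in (0 : ℝ)..(Real.log 2 / L), dickmanRho (u - s) ≤ L * (Real.log 2 / L * dickmanRho (u - 1)) :=
            mul_le_mul_of_nonneg_left h2 hL0.le
        _ = Real.log 2 * dickmanRho (u - 1) := by field_simp
        _ ≤ 1 * dickmanRho (u - 1) := by gcongr
        _ = dickmanRho (u - 1) := one_mul _
  rw [hLL, hsplit] at h1
  have hρ := dickmanRho_nonneg (u - 1)
  rw [abs_le] at h1 ⊢
  constructor <;> nlinarith [h1.1, h1.2, hsmall.1, hsmall.2]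

/-- **The weight of the small primes `p ≤ √y` is at most one half**:
`Σ_{p ≤ √y} (log p/p) ρ(u - log p/log y) ≤ u ρ(u) (log y)/2 + C ρ(u - 1)` for `u > 2`, `y ≥ 4`.
[cite: Hildebrand1986, §3] -/
theorem weightedPrimeSum_sqrt_le :
    ∃ C : ℝ, 0 ≤ C ∧ ∀ (u : ℝ) (y : ℕ), 2 < u → 4 ≤ y →
      ∑ p ∈ Nat.primesLE ⌊Real.sqrt y⌋₊, Real.log p / p * dickmanRho (u - Real.log p / Real.log y) ≤
        u * dickmanRho u * Real.log y / 2 + C * dickmanRho (u - 1) := by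
  obtain ⟨C, hC0, hC⟩ := abs_sum_primesLE_log_div_mul_sub_integral_le
  refine ⟨C, hC0, fun u y hu hy => ?_⟩
  have hy4 : (4 : ℝ) ≤ y := by exact_mod_cast hy
  have hy0 : (0 : ℝ) ≤ y := by linarith
  set L := Real.log y with hL
  have hL0 : 0 < L := Real.log_pos (by linarith)
  set z := Real.sqrt y with hz
  have hz2 : 2 ≤ z := by
    rw [hz, show (2 : ℝ) = Real.sqrt 4 by rw [show (4 : ℝ) = 2 ^ 2 by norm_num, Real.sqrt_sq (by norm_num)]]
    exact Real.sqrt_le_sqrt hy4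
  have hlogz : Real.log z = L / 2 := by rw [hz, Real.log_sqrt hy0]
  obtain ⟨hd, hc, h0', h0, hM⟩ := weight_calculus (z := z) hu hL0 (by rw [hlogz]; linarith)
  have h1 := hC _ _ (dickmanRho (u - 1)) z hz2 hd hc h0' h0 hM
  rw [integral_weight_div_eq hL0 hz2, hlogz, show L / 2 / L = 1 / 2 by field_simp] at h1
  have hcont : Continuous fun s : ℝ => dickmanRho (u - s) := continuous_dickmanRho.comp (continuous_const.sub continuous_id)
  -- extend the integral down to `0` and use the one-half bound
  have hl2L : 0 ≤ Real.log 2 / L := by positivity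
  have hext : ∫ s in (Real.log 2 / L)..(1 / 2), dickmanRho (u - s) ≤ u * dickmanRho u / 2 := by
    have hadd := intervalIntegral.integral_add_adjacent_intervals (μ := volume) (a := (0 : ℝ)) (b := Real.log 2 / L)
      (c := 1 / 2) (hcont.intervalIntegrable _ _) (hcont.intervalIntegrable _ _)
    have hnn : 0 ≤ ∫ s in (0 : ℝ)..(Real.log 2 / L), dickmanRho (u - s) :=
      intervalIntegral.integral_nonneg hl2L fun s _ => dickmanRho_nonneg _
    have := integral_dickmanRho_sub_half_le (u := u) (by linarith)
    linarith
  have := (abs_le.1 h1).2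
  nlinarith [hext, hL0]

end HildebrandInduction

end Literature.NumberTheory.Sieve

end
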